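/-
HONEST FRAMING: systematic search; no irrationality claim unless certified.
-/
import Summits.KontsevichZagierPeriods.Zeta5Search.WedgeDictionaryGhostFace
import HarnessLib

/-!
# The `{4,6}` two-top face of `explicitPQ` from its datum (PROVED reduction) — the second half of the ghost class

D2 lane, gen-1 g16 (planner-pub-zeta5-gen-1-g16-0), 2026-08-21; sequel of `WedgeDictionaryGhostRay` /
`WedgeDictionaryGhostFace` (memo `pub-zeta5-gen-1/D2-INDUCTION-g16.md` §3.12), the mirror image `1 ↔ 4`.

## What is proved

The ghost class of the memo (§1, §3.3: odd level `N`, a non-edge pair of slots at the top value `(N+1)/2`) has two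
components, the top pairs `{1,6}` (treated in `WedgeDictionaryGhostFace`) and `{4,6}` (this file).  We prove
(`explicitPQAt_twoTop46`):

  under the four relation families `CellStar`, `DictStar`, `CellPencil`, `DictPencil` of `WedgeDictionaryThreeTerm`
  (conjectural tree statements, hypotheses here), `explicitPQ` at the single datum `H_0 = (1,0,1,0,0,0,0,1)`
  (`b = (1; 0,0,0,1,0,1,0)`) implies `explicitPQ` (partner index `2`) at EVERY point of the `{4,6}` two-top face
  (`TwoTop46 a`: `b₆ = b₄`, `2b₄ = b₀ + 1`).

Mechanism (as for `{1,6}`): on the face `χ₄Π₄(b) = (b₀+1−b₄−b₅)(b₀+1−b₄−b₆) = 0`, so PENCIL(`H_n`, 4) and the STARs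
`(4,k)`, `k ∈ {1,2,3,5,7}`, are two-term transfers; the ray `H_n = (2n+1, 0, 2n+1, 0, n, n, n, 2n+1)`
(`b = (2n+1; 0,0,0,n+1,0,n+1,0)`) is climbed by the chain `H_n ↦ H_n + DS ↦ −s₁ ↦ −s₂ ↦ −s₃ ↦ −s₅ ↦ −s₇ = H_{n+1}`
with non-zero coefficients `(n+2)², 2(n+1)², 2(n+1), 2(n+1), (n+1)(2n+3), (2n+3)²`, and the face at each level is
swept by induction on `b₁+b₂+b₃+b₅+b₇` (`κ(4,k) = (t−b_k)² ≠ 0`, the region being closed under slot-down moves,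
`regionHyp_slotDown`).  Together with `explicitPQAt_twoTop16`: THE WHOLE GHOST CLASS COSTS EXACTLY TWO DATA,
`I(0,0,1,0,1,0,0,1)` and `I(1,0,1,0,0,0,0,1)` (both predicted to equal `1` by the dictionary, memo §3.4/§3.9).

What this file is NOT: a proof of any STAR/PENCIL instance or of the data, or of anything about irrationality.
-/

noncomputable section

open Finset

namespace Summit.KontsevichZagierPeriods.Zeta5Search.WedgeDictionary

open Literature.NumberTheory.Irrationality.BrownZudilin2022 (bOfA Converges convergenceForms cellularIntegral QOf)

/-! ## 1. The `{4,6}` ray and its chain, in `a`-coordinates -/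

/-- The `{4,6}` ray `H_n`: `a = (2n+1, 0, 2n+1, 0, n, n, n, 2n+1)`, i.e. `b(a) = (2n+1; 0,0,0, n+1, 0, n+1, 0)`. -/
def ghostB (n : ℕ) : Fin 8 → ℤ :=
  ![2 * (n : ℤ) + 1, 0, 2 * (n : ℤ) + 1, 0, (n : ℤ), (n : ℤ), (n : ℤ), 2 * (n : ℤ) + 1]

/-- Chain point 0 (the PENCIL apex `DS H_n`): `b = (2n+3; 1,1,1, n+2, 1, n+2, 1)`. -/
def ghostQ0 (n : ℕ) : Fin 8 → ℤ :=
  ![2 * (n : ℤ) + 1, 1, 2 * (n : ℤ) + 1, 1, (n : ℤ), (n : ℤ), (n : ℤ), 2 * (n : ℤ) + 1]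

/-- Chain point 1 (`= Q0 − s₁`): `b = (2n+3; 0,1,1, n+2, 1, n+2, 1)`. -/
def ghostQ1 (n : ℕ) : Fin 8 → ℤ :=
  ![2 * (n : ℤ) + 2, 1, 2 * (n : ℤ) + 1, 1, (n : ℤ), (n : ℤ), (n : ℤ), 2 * (n : ℤ) + 1]

/-- Chain point 2 (`= Q1 − s₂`): `b = (2n+3; 0,0,1, n+2, 1, n+2, 1)`. -/
def ghostQ2 (n : ℕ) : Fin 8 → ℤ :=
  ![2 * (n : ℤ) + 3, 0, 2 * (n : ℤ) + 2, 1, (n : ℤ), (n : ℤ), (n : ℤ), 2 * (n : ℤ) + 1]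

/-- Chain point 3 (`= Q2 − s₃`): `b = (2n+3; 0,0,0, n+2, 1, n+2, 1)`. -/
def ghostQ3 (n : ℕ) : Fin 8 → ℤ :=
  ![2 * (n : ℤ) + 3, 0, 2 * (n : ℤ) + 3, 0, (n : ℤ) + 1, (n : ℤ), (n : ℤ), 2 * (n : ℤ) + 2]

/-- Chain point 4 (`= Q3 − s₅`): `b = (2n+3; 0,0,0, n+2, 0, n+2, 1)`; `Q4 − s₇ = H_{n+1}`. -/
def ghostQ4 (n : ℕ) : Fin 8 → ℤ :=
  ![2 * (n : ℤ) + 3, 0, 2 * (n : ℤ) + 3, 0, (n : ℤ) + 1, (n : ℤ) + 1, (n : ℤ), 2 * (n : ℤ) + 3]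

/-- The dual coordinates of the `{4,6}` ray: `b(H_n) = (2n+1; 0, 0, 0, n+1, 0, n+1, 0)`. -/
theorem bOfA_ghostB (n : ℕ) :
    bOfA (ghostB n) 0 = 2 * (n : ℤ) + 1 ∧ bOfA (ghostB n) 1 = 0 ∧ bOfA (ghostB n) 2 = 0 ∧ bOfA (ghostB n) 3 = 0 ∧
      bOfA (ghostB n) 4 = (n : ℤ) + 1 ∧ bOfA (ghostB n) 5 = 0 ∧ bOfA (ghostB n) 6 = (n : ℤ) + 1 ∧
        bOfA (ghostB n) 7 = 0 := by
  refine ⟨?_, ?_, ?_, ?_, ?_, ?_, ?_, ?_⟩ <;> simp [bOfA, ghostB] <;> ring1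

/-- `H_0` is the datum `a = (1,0,1,0,0,0,0,1)`. -/
theorem ghostB_zero : ghostB 0 = ![1, 0, 1, 0, 0, 0, 0, 1] := by
  ext i; fin_cases i <;> simp [ghostB]

/-- The six moves of the chain land on the named points. -/
theorem ghost46_chain (n : ℕ) :
    ghostB n + dsUp = ghostQ0 n ∧ ghostQ0 n + slotDown 1 = ghostQ1 n ∧ ghostQ1 n + slotDown 2 = ghostQ2 n ∧
      ghostQ2 n + slotDown 3 = ghostQ3 n ∧ ghostQ3 n + slotDown 5 = ghostQ4 n ∧
        ghostQ4 n + slotDown 7 = ghostB (n + 1) := by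
  refine ⟨?_, ?_, ?_, ?_, ?_, ?_⟩ <;> ext i <;> fin_cases i <;>
    simp [ghostB, ghostQ0, ghostQ1, ghostQ2, ghostQ3, ghostQ4, dsUp, slotDown, Nat.cast_add, Nat.cast_one] <;> ring1

/-! ## 2. The twelve points of the chain lie in the region (partner index `j = 2`) -/

section Region

/-- All chain points (and their slot-down partners) are region points with partner index `2`: for explicit
vectors with entries linear in `n` the seventeen forms, the box, `d ≥ 0` and the partner condition are `omega` facts. -/
theorem region_chain46_all (n : ℕ) :
    RegionHyp (ghostB n) 2 ∧
      RegionHyp (ghostQ0 n) 2 ∧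
      RegionHyp (ghostQ0 n + slotDown 4) 2 ∧
      RegionHyp (ghostQ1 n) 2 ∧
      RegionHyp (ghostQ1 n + slotDown 4) 2 ∧
      RegionHyp (ghostQ2 n) 2 ∧
      RegionHyp (ghostQ2 n + slotDown 4) 2 ∧
      RegionHyp (ghostQ3 n) 2 ∧
      RegionHyp (ghostQ3 n + slotDown 4) 2 ∧
      RegionHyp (ghostQ4 n) 2 ∧
      RegionHyp (ghostQ4 n + slotDown 4) 2 := by
  refine ⟨?_, ?_, ?_, ?_, ?_, ?_, ?_, ?_, ?_, ?_, ?_⟩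
  all_goals
    refine ⟨by simp, ?_, ?_, ?_, ?_⟩
    · intro x hx
      simp [convergenceForms, ghostB, ghostQ0, ghostQ1, ghostQ2, ghostQ3, ghostQ4, slotDown] at hx
      omega
    · intro i hi
      simp only [mem_Icc] at hi
      obtain ⟨h1, h7⟩ := hi
      interval_cases i <;> simp [bOfA, ghostB, ghostQ0, ghostQ1, ghostQ2, ghostQ3, ghostQ4, slotDown] <;> omega
    · simp [dOf, Finset.sum_range_succ, bOfA, ghostB, ghostQ0, ghostQ1, ghostQ2, ghostQ3, ghostQ4, slotDown]
      all_goals omega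
    · simp [bOfA, ghostB, ghostQ0, ghostQ1, ghostQ2, ghostQ3, ghostQ4, slotDown]
      all_goals omega


/-- `H_n` is a region point. -/
theorem region_ghostB (n : ℕ) : RegionHyp (ghostB n) 2 := (region_chain46_all n).1
/-- `Q0` is a region point. -/
theorem region_ghostQ0 (n : ℕ) : RegionHyp (ghostQ0 n) 2 := (region_chain46_all n).2.1
/-- `Q0 − s₄` is a region point. -/
theorem region_ghostQ0' (n : ℕ) : RegionHyp (ghostQ0 n + slotDown 4) 2 := (region_chain46_all n).2.2.1
/-- `Q1` is a region point. -/
theorem region_ghostQ1 (n : ℕ) : RegionHyp (ghostQ1 n) 2 := (region_chain46_all n).2.2.2.1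
/-- `Q1 − s₄` is a region point. -/
theorem region_ghostQ1' (n : ℕ) : RegionHyp (ghostQ1 n + slotDown 4) 2 := (region_chain46_all n).2.2.2.2.1
/-- `Q2` is a region point. -/
theorem region_ghostQ2 (n : ℕ) : RegionHyp (ghostQ2 n) 2 := (region_chain46_all n).2.2.2.2.2.1
/-- `Q2 − s₄` is a region point. -/
theorem region_ghostQ2' (n : ℕ) : RegionHyp (ghostQ2 n + slotDown 4) 2 := (region_chain46_all n).2.2.2.2.2.2.1
/-- `Q3` is a region point. -/
theorem region_ghostQ3 (n : ℕ) : RegionHyp (ghostQ3 n) 2 := (region_chain46_all n).2.2.2.2.2.2.2.1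
/-- `Q3 − s₄` is a region point. -/
theorem region_ghostQ3' (n : ℕ) : RegionHyp (ghostQ3 n + slotDown 4) 2 := (region_chain46_all n).2.2.2.2.2.2.2.2.1
/-- `Q4` is a region point. -/
theorem region_ghostQ4 (n : ℕ) : RegionHyp (ghostQ4 n) 2 := (region_chain46_all n).2.2.2.2.2.2.2.2.2.1
/-- `Q4 − s₄` is a region point. -/
theorem region_ghostQ4' (n : ℕ) : RegionHyp (ghostQ4 n + slotDown 4) 2 := (region_chain46_all n).2.2.2.2.2.2.2.2.2.2

end Region

/-! ## 3. The coefficients along the chain and the ray theorem -/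

/-- The vanishing third coefficients `χ₄Π₄ = 0` (slots 4, 6 at the top value) and the non-zero transfer
coefficients `(n+2)², 2(n+1)², 2(n+1), 2(n+1), (n+1)(2n+3), (2n+3)²`. -/
theorem ghost46_coeffs (n : ℕ) :
    pencilApex (bOfA (ghostB n)) 4 = ((n : ℤ) + 2) ^ 2 ∧ fanCoeff (bOfA (ghostQ0 n)) 4 = 0 ∧
      fanCoeff (bOfA (ghostQ0 n)) 1 = 2 * ((n : ℤ) + 1) ^ 2 ∧ fanCoeff (bOfA (ghostQ1 n)) 4 = 0 ∧
        fanCoeff (bOfA (ghostQ1 n)) 2 = 2 * ((n : ℤ) + 1) ∧ fanCoeff (bOfA (ghostQ2 n)) 4 = 0 ∧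
          fanCoeff (bOfA (ghostQ2 n)) 3 = 2 * ((n : ℤ) + 1) ∧ fanCoeff (bOfA (ghostQ3 n)) 4 = 0 ∧
            fanCoeff (bOfA (ghostQ3 n)) 5 = ((n : ℤ) + 1) * (2 * (n : ℤ) + 3) ∧ fanCoeff (bOfA (ghostQ4 n)) 4 = 0 ∧
              fanCoeff (bOfA (ghostQ4 n)) 7 = (2 * (n : ℤ) + 3) ^ 2 := by
  refine ⟨?_, ?_, ?_, ?_, ?_, ?_, ?_, ?_, ?_, ?_, ?_⟩ <;>
    simp [pencilApex, fanCoeff, chiOf, nonEdgePartners, bOfA, ghostB, ghostQ0, ghostQ1, ghostQ2, ghostQ3,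
      ghostQ4, -mul_eq_zero] <;> ring1

/-- **THE (4,6) TWO-TOP RAY TEMPLATE (PROVED).** Under the four relation families, `explicitPQ` at `H_n` implies
`explicitPQ` at `H_{n+1}`: PENCIL(`H_n`,4) to the apex, then the degenerate STARs `(4,1), (4,2), (4,3), (4,5),
(4,7)`. [folklore] -/
theorem explicitPQAt_ghost46_succ (hcS : CellStar) (hdS : DictStar) (hcP : CellPencil) (hdP : DictPencil) (n : ℕ)
    (h : ExplicitPQAt (ghostB n) 2) : ExplicitPQAt (ghostB (n + 1)) 2 := by
  obtain ⟨e0, e1, e2, e3, e4, e5⟩ := ghost46_chain n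
  obtain ⟨cA, c04, c01, c14, c12, c24, c23, c34, c35, c44, c47⟩ := ghost46_coeffs n
  have four7 : (4 : ℕ) ∈ Icc 1 7 := by simp
  -- step 0: PENCIL(H_n, 4): H_n ↦ Q0 = H_n + DS
  have h0 : ExplicitPQAt (ghostQ0 n) 2 := by
    have r₁ : RegionHyp (ghostB n + dsUp) 2 := by rw [e0]; exact region_ghostQ0 n
    have r₂ : RegionHyp (ghostB n + dsUp + slotDown 4) 2 := by rw [e0]; exact region_ghostQ0' n
    have hβ : pencilApex (bOfA (ghostB n)) 4 ≠ 0 := by rw [cA]; positivity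
    have hγ : fanCoeff (bOfA (ghostB n + dsUp)) 4 = 0 := by rw [e0]; exact c04
    have := at_pencil_apex hcP hdP four7 (region_ghostB n) r₁ r₂ h hβ hγ
    rw [e0] at this; exact this
  -- step 1: STAR(4,1) at Q0: Q0 ↦ Q1
  have h1 : ExplicitPQAt (ghostQ1 n) 2 := by
    have r₁ : RegionHyp (ghostQ0 n + slotDown 1) 2 := by rw [e1]; exact region_ghostQ1 n
    have hβ : fanCoeff (bOfA (ghostQ0 n)) 1 ≠ 0 := by rw [c01]; positivity
    have := at_star_mid hcS hdS four7 (by simp) (by decide) (region_ghostQ0 n) r₁ (region_ghostQ0' n) h0 hβ c04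
    rw [e1] at this; exact this
  -- step 2: STAR(4,2) at Q1: Q1 ↦ Q2
  have h2 : ExplicitPQAt (ghostQ2 n) 2 := by
    have r₁ : RegionHyp (ghostQ1 n + slotDown 2) 2 := by rw [e2]; exact region_ghostQ2 n
    have hβ : fanCoeff (bOfA (ghostQ1 n)) 2 ≠ 0 := by rw [c12]; positivity
    have := at_star_mid hcS hdS four7 (by simp) (by decide) (region_ghostQ1 n) r₁ (region_ghostQ1' n) h1 hβ c14
    rw [e2] at this; exact this
  -- step 3: STAR(4,3) at Q2: Q2 ↦ Q3
  have h3 : ExplicitPQAt (ghostQ3 n) 2 := by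
    have r₁ : RegionHyp (ghostQ2 n + slotDown 3) 2 := by rw [e3]; exact region_ghostQ3 n
    have hβ : fanCoeff (bOfA (ghostQ2 n)) 3 ≠ 0 := by rw [c23]; positivity
    have := at_star_mid hcS hdS four7 (by simp) (by decide) (region_ghostQ2 n) r₁ (region_ghostQ2' n) h2 hβ c24
    rw [e3] at this; exact this
  -- step 4: STAR(4,5) at Q3: Q3 ↦ Q4
  have h4 : ExplicitPQAt (ghostQ4 n) 2 := by
    have r₁ : RegionHyp (ghostQ3 n + slotDown 5) 2 := by rw [e4]; exact region_ghostQ4 n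
    have hβ : fanCoeff (bOfA (ghostQ3 n)) 5 ≠ 0 := by rw [c35]; positivity
    have := at_star_mid hcS hdS four7 (by simp) (by decide) (region_ghostQ3 n) r₁ (region_ghostQ3' n) h3 hβ c34
    rw [e4] at this; exact this
  -- step 5: STAR(4,7) at Q4: Q4 ↦ Q4 − s₇ = H_{n+1}
  have r₁ : RegionHyp (ghostQ4 n + slotDown 7) 2 := by rw [e5]; exact region_ghostB (n + 1)
  have hβ : fanCoeff (bOfA (ghostQ4 n)) 7 ≠ 0 := by rw [c47]; positivity
  have := at_star_mid hcS hdS four7 (by simp) (by decide) (region_ghostQ4 n) r₁ (region_ghostQ4' n) h4 hβ c44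
  rw [e5] at this; exact this

/-- **THE `{4,6}` RAY FROM ONE DATUM (PROVED).** Under the four relation families, `explicitPQ` at the datum
`H_0 = (1,0,1,0,0,0,0,1)` gives `explicitPQ` along the whole ray `H_n = (2n+1,0,2n+1,0,n,n,n,2n+1)`. [folklore] -/
theorem explicitPQAt_ghost46_ray (hcS : CellStar) (hdS : DictStar) (hcP : CellPencil) (hdP : DictPencil)
    (h0 : ExplicitPQAt ![1, 0, 1, 0, 0, 0, 0, 1] 2) (n : ℕ) : ExplicitPQAt (ghostB n) 2 := by
  induction n with
  | zero => rw [ghostB_zero]; exact h0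
  | succ k ih => exact explicitPQAt_ghost46_succ hcS hdS hcP hdP k ih

/-! ## 4. The `{4,6}` two-top face -/

/-- The `{4,6}` two-top face: `b₆ = b₄` and `2b₄ = b₀ + 1`. -/
def TwoTop46 (a : Fin 8 → ℤ) : Prop := bOfA a 6 = bOfA a 4 ∧ 2 * bOfA a 4 = bOfA a 0 + 1

/-- On the face the fan coefficient of slot `4` vanishes: `χ₄Π₄ = (b₀+1−b₄−b₅)(b₀+1−b₄−b₆) = 0`. -/
theorem fanCoeff_four_of_twoTop46 {a : Fin 8 → ℤ} (hf : TwoTop46 a) : fanCoeff (bOfA a) 4 = 0 := by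
  obtain ⟨h6, h4⟩ := hf
  have hz : bOfA a 0 + 1 - bOfA a 4 - bOfA a 6 = 0 := by omega
  simp [fanCoeff, chiOf, nonEdgePartners, hz]

/-- The face is closed under the slot-down moves in the slots `1,2,3,5,7`. -/
theorem twoTop46_slotDown {a : Fin 8 → ℤ} (hf : TwoTop46 a) {k : ℕ} (hk : k ∈ Icc 1 7) (hk4 : k ≠ 4) (hk6 : k ≠ 6) :
    TwoTop46 (a + slotDown k) := by
  obtain ⟨h6, h4⟩ := hf
  refine ⟨?_, ?_⟩
  · rw [bOfA_add_slotDown a k hk 6 (by norm_num), bOfA_add_slotDown a k hk 4 (by norm_num)]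
    simp [Ne.symm hk4, Ne.symm hk6, h6]
  · have hk0 : (0 : ℕ) ≠ k := by have := (mem_Icc.1 hk).1; omega
    rw [bOfA_add_slotDown a k hk 4 (by norm_num), bOfA_add_slotDown a k hk 0 (by norm_num)]
    simp [Ne.symm hk4, hk0, h4]

/-- A face point with `b₁ = b₂ = b₃ = b₅ = b₇ = 0` is the ray point `H_n`, `n = a₄`. -/
theorem eq_ghostB_of_twoTop46 {a : Fin 8 → ℤ} (hf : TwoTop46 a) (hconv : Converges a)
    (hz : bOfA a 1 = 0 ∧ bOfA a 2 = 0 ∧ bOfA a 3 = 0 ∧ bOfA a 5 = 0 ∧ bOfA a 7 = 0) :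
    a = ghostB (a 4).toNat := by
  obtain ⟨h6, h4⟩ := hf
  obtain ⟨z1, z2, z3, z5, z7⟩ := hz
  have hF := forms_of_converges hconv
  have hn : ((a 4).toNat : ℤ) = a 4 := Int.toNat_of_nonneg hF.2.2.2.2.1
  simp only [bOfA] at h6 h4 z1 z2 z3 z5 z7
  ext i
  fin_cases i <;> simp [ghostB, hn] <;> omega

/-- **THE `{4,6}` TWO-TOP FACE FROM ONE DATUM (PROVED).** Under the four relation families, `explicitPQ` at the datum
`(1,0,1,0,0,0,0,1)` implies `explicitPQ` (partner `2`) at every region point of the `{4,6}` two-top face.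
Induction on `b₁+b₂+b₃+b₅+b₇` by the degenerate STARs `(4,k)`, then `explicitPQAt_ghost46_ray`. [folklore] -/
theorem explicitPQAt_twoTop46 (hcS : CellStar) (hdS : DictStar) (hcP : CellPencil) (hdP : DictPencil)
    (h0 : ExplicitPQAt ![1, 0, 1, 0, 0, 0, 0, 1] 2) :
    ∀ a : Fin 8 → ℤ, RegionHyp a 2 → TwoTop46 a → ExplicitPQAt a 2 := by
  suffices H : ∀ s : ℕ, ∀ a : Fin 8 → ℤ, RegionHyp a 2 → TwoTop46 a →
      (bOfA a 1 + bOfA a 2 + bOfA a 3 + bOfA a 5 + bOfA a 7).toNat = s → ExplicitPQAt a 2 from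
    fun a hr hf => H _ a hr hf rfl
  intro s
  induction s using Nat.strong_induction_on with
  | _ s ih =>
    intro a hr hf hs
    have hr' := hr
    obtain ⟨hj, hconv, hbox, hd, hpart⟩ := hr'
    have hF := forms_of_converges hconv
    have hb1 := hbox 1 (by simp)
    have hb2 := hbox 2 (by simp)
    have hb3 := hbox 3 (by simp)
    have hb4 := hbox 4 (by simp)
    have hb5 := hbox 5 (by simp)
    have hb7 := hbox 7 (by simp)
    have hf' := hf
    obtain ⟨h6, h4⟩ := hf'
    by_cases hz : bOfA a 1 = 0 ∧ bOfA a 2 = 0 ∧ bOfA a 3 = 0 ∧ bOfA a 5 = 0 ∧ bOfA a 7 = 0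
    · rw [eq_ghostB_of_twoTop46 hf hconv hz]
      exact explicitPQAt_ghost46_ray hcS hdS hcP hdP h0 _
    · -- a slot `k ∈ {1,2,3,5,7}` with `b_k ≥ 1`: STAR(4,k) at `a` is two-term and lifts from `a − s_k`
      have hγ := fanCoeff_four_of_twoTop46 hf
      have four7 : (4 : ℕ) ∈ Icc 1 7 := by simp
      have hpos4 : 1 ≤ bOfA a 4 := by simp only [bOfA] at h4 hb4 ⊢; omega
      have r₂ : RegionHyp (a + slotDown 4) 2 := regionHyp_slotDown hr four7 hpos4
      -- the generic step for a slot `k`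
      have step : ∀ k : ℕ, k ∈ Icc 1 7 → k ≠ 4 → k ≠ 6 → 1 ≤ bOfA a k →
          starKappa (bOfA a) 4 k ≠ 0 → ExplicitPQAt a 2 := by
        intro k hk hk4 hk6 hposk hκ
        have r₁ : RegionHyp (a + slotDown k) 2 := regionHyp_slotDown hr hk hposk
        have hf₁ : TwoTop46 (a + slotDown k) := twoTop46_slotDown hf hk hk4 hk6
        have hlt : (bOfA (a + slotDown k) 1 + bOfA (a + slotDown k) 2 + bOfA (a + slotDown k) 3 +
            bOfA (a + slotDown k) 5 + bOfA (a + slotDown k) 7).toNat < s := by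
          have hk' := hk
          simp only [mem_Icc] at hk'
          obtain ⟨hk1', hk7'⟩ := hk'
          interval_cases k <;> simp [bOfA, slotDown] at hposk hb1 hb2 hb3 hb5 hb7 hs ⊢ <;> omega
        have ih₁ := ih _ hlt (a + slotDown k) r₁ hf₁ rfl
        exact at_star_first hcS hdS four7 hk (Ne.symm hk4) hr r₁ r₂ ih₁ hκ hγ
      -- `κ(4,k) = (b₄−b_k)(b₀+1−b₄−b_k) = (t−b_k)² ≠ 0` on the face because `b_k ≤ (N−1)/2 < b₄` (edge forms
      -- `N−b₄−b_k ≥ 0` for `k = 1,2,3,7`, and `N−b₅−b₆ ≥ 0` for `k = 5`)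
      have hκ : ∀ k : ℕ, k ∈ Icc 1 7 → k ≠ 4 → k ≠ 6 → starKappa (bOfA a) 4 k ≠ 0 := by
        intro k hk hk4 hk6
        have hk' := hk
        simp only [mem_Icc] at hk'
        obtain ⟨hk1', hk7'⟩ := hk'
        interval_cases k <;> simp only [starKappa, bOfA] at h4 h6 ⊢ <;> first
          | exact absurd rfl hk4 | exact absurd rfl hk6
          | exact mul_ne_zero (by omega) (by omega)
      have hsome : 1 ≤ bOfA a 1 ∨ 1 ≤ bOfA a 2 ∨ 1 ≤ bOfA a 3 ∨ 1 ≤ bOfA a 5 ∨ 1 ≤ bOfA a 7 := by omega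
      rcases hsome with h | h | h | h | h
      · exact step 1 (by simp) (by decide) (by decide) h (hκ 1 (by simp) (by decide) (by decide))
      · exact step 2 (by simp) (by decide) (by decide) h (hκ 2 (by simp) (by decide) (by decide))
      · exact step 3 (by simp) (by decide) (by decide) h (hκ 3 (by simp) (by decide) (by decide))
      · exact step 5 (by simp) (by decide) (by decide) h (hκ 5 (by simp) (by decide) (by decide))
      · exact step 7 (by simp) (by decide) (by decide) h (hκ 7 (by simp) (by decide) (by decide))

/-- **THE GHOST CLASS FROM TWO DATA (PROVED).** Under the four relation families, the two data `I(0,0,1,0,1,0,0,1)`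
and `I(1,0,1,0,0,0,0,1)` (as `explicitPQ` instances) give `explicitPQ` on both two-top faces `{1,6}` and `{4,6}`.
[folklore] -/
theorem explicitPQAt_ghostClass (hcS : CellStar) (hdS : DictStar) (hcP : CellPencil) (hdP : DictPencil)
    (h16 : ExplicitPQAt ![0, 0, 1, 0, 1, 0, 0, 1] 2) (h46 : ExplicitPQAt ![1, 0, 1, 0, 0, 0, 0, 1] 2)
    (a : Fin 8 → ℤ) (hr : RegionHyp a 2) (hf : TwoTop16 a ∨ TwoTop46 a) : ExplicitPQAt a 2 := by
  rcases hf with hf | hf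
  · exact explicitPQAt_twoTop16 hcS hdS hcP hdP h16 a hr hf
  · exact explicitPQAt_twoTop46 hcS hdS hcP hdP h46 a hr hf

end Summit.KontsevichZagierPeriods.Zeta5Search.WedgeDictionary
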